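/-
Copyright (c) 2026 the pub-hodgecm-mathlib formalisation cell (harness21).  Prover seat hodgecm-mathlib-LH4-p18 (g5), req620 Track A «(D-RAM) FOUR-FRAME» squad
(STAGE-1b, row (2) of the piece `f_{T₊}`, the (β₂) road (R-36), the K6 road; K6 desk LH4-p16 (g3) WORD #29 (2a) «p18: TOP-OF-ROW» — the A6 skeleton's `htop` branch
`W ≥ 1` as ONE named wrapper, so `core_holds` ∕ `coreOdd_holds` end in two `exact`s), 2026-09-05.
-/
import Summits.HodgeConjecture.HodgeConjecture.Theorems.F0P3cDyRamTopCellIdentity              -- ★ A5 p865015 (LH4-p15 (g3)): `topCell_identity` (the top cell identity, density as a LETTER)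
import Summits.HodgeConjecture.HodgeConjecture.Theorems.F0P3cDyRamRowTopChartLetters           -- ★ A1-top p865011 (LH4-p15 (g3) over LH4-p12 (g9)): `exists_rowTopChart_letters` (the row's TOP chart)
import Summits.HodgeConjecture.HodgeConjecture.Theorems.F0P3cDyRamTopCellDensityOfRow          -- ★ A5-SIZES p865144 (LH4-p08 (g12)): `exists_topCell_density_of_row`, `…_of_row_odd` (the density letters from the row)
import Summits.HodgeConjecture.HodgeConjecture.Theorems.F0P3cDyRamDiagonalFixedClassSystems    -- ★ κG-B1 (LH4-p09 (g3)): `exists_repr_fixedBall_card` (the fine `σ`-fixed digit system)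
import HarnessLib

/-!
# Crux `H413`, line LH4 «(D-RAM) FOUR-FRAME» — STAGE-1b, row (2), the (β₂) road (R-36), the K6 road, A6 node (2a) «TOP-OF-ROW»: the top cell identity of ★ A5 `topCell_identity`
# FROM THE ROW ALONE — the TOP chart, the top digit system and the top density letters all obtained inside; BOTH parities in one statement

Cell `hodgecm-mathlib` (D-0151), FLOOR 0, crux item H413 = `stmt-HodgeConjecture-24833`, route of record `HCCMUnconditional`; squad F0∕P3c∕LH4; lane
`--supports stmt-HodgeConjecture-24833 --as helper` (count-neutral; pays NO tier-0 row).  THEOREMS ONLY (no `def`, no instance, no notation, no `sorry`, default heartbeats);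
★-only imports; states NO law; GENERIC (no CM token); ‹CORE›∕‹CORE-ODD›∕(β₂) stay HYPOTHESES of their consumers.

WHAT (K6 desk LH4-p16 (g3) WORD #29 (2a); the desk's A6 skeleton v4 `core_holds` ll. 231–239 and its odd twin v3 ARE this proof).  ★ A5 `topCell_identity` (p865015) proves the
A6 skeleton's fourth hole `htop` — `X_H(b + 2N) = if N < d then X_A(b + 2N) else 0` at the TOP cell `j = b + 2N` of the live row `2b + d%2 = m`, window `m + 2N = jl`, `N ≥ 1` —
from ‹CORE.v1›'s∕‹CORE-ODD.v1›'s two-frame letters PLUS three groups of letters the assembler would otherwise have to build in place: the row's TOP chart («A1-top» v2's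
conjuncts), a top digit system `Rd` modulo `|ϖ|^n` (`2d − 1 ≤ n ≤ b`) and the top DENSITY letters `hdensH`, `hdensA`.  All three are ★: ★ A1-top `exists_rowTopChart_letters`
(p865011), ★ `exists_repr_fixedBall_card` (κG-B1, at level `t := 0`, modulus `n := b`), ★ A5-SIZES `exists_topCell_density_of_row` ∕ `exists_topCell_density_of_row_odd` (p865144).
THIS FILE is the composition, ONCE, as a named theorem with its own elaboration budget (the desk's heartbeat measurement on skeleton v4: the whole of `core_holds` as one command
sits at the default ceiling), so that the A6 assemblers' `W ≥ 1` top branch is ONE `exact`: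
* `topCell_identity_of_row`: hypotheses = ★ `topCell_identity`'s letters BY NAME AND ORDER through the K6 floor (`σ ϖ d tE hD jE ρ Θ α lam hρρ … hϖmax u m jl hm hjl hum h2`; the
  hyperbolic frame `γ₂ hΓ φ h hφs hφi hφo hφγ hform hΘh hh` + ‹CORE.v1›'s isotropic vector `hhyper`, `f hfinLS hf`; the anisotropic frame `P₁ dg η γA hA hΓ' hdg1 hdgσ hησ hη1 hηN φ′ h′ …
  hh′` + ‹CORE.v1›'s anisotropy premise `haniso`, `f′ hfinLS′ hf′`; the floor `{N₀} h4d hN₀m hu1N hlam1`), then the row `(b) (hb1 : 1 ≤ b) (hbm : 2 * b + d % 2 = m)` and the window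
  `(hN1 : 1 ≤ N) (hNjl : m + 2 * N = jl)` — NO chart, NO digit system, NO density letters ⟹ ★ `topCell_identity`'s CONCLUSION BYTE-IDENTICAL.
  ROW LETTER.  ★ A5's own `hbm : 2b + d%2 = m` (both parities in one statement); the parity split ★ A5-SIZES needs (`2b = m` even ∕ `2b + 1 = m` odd) happens INSIDE by
  `Nat.mod_two_eq_zero_or_one d` — the parity of `d` is NOT derivable from the wrapper's letters (★ `depth_mod_two_eq` wants `tE < m`, which ★ A5's floor does not carry), so a
  split into two names would cost an explicit parity letter each; the A6 call sites have `hd0 : d % 2 = 0` ∕ `hd1 : d % 2 = 1` in scope and pass `(by omega)` for `hbm`.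
MECHANISM (ll. 231–239 of the desk's skeleton v4, token for token): `obtain ⟨κ₀, ξ₀, μa, μb, R₀, γ₀, α₁, γ₁, …⟩ := ★ exists_rowTopChart_letters … hm hjl hbm hN1 hNjl` (the `q`
of its `hq` unifies with `Nat.card 𝓀[E]`); `obtain ⟨Rt, h1, h2, h3, -⟩ := ★ exists_repr_fixedBall_card hσσ hvσ hfix hϖ hdiff b 0` (from `hD`'s fields) and
`simp only [Nat.mul_zero, pow_zero, Nat.add_zero]`; `2d − 1 ≤ b` by `omega` from `4d ≤ N₀ ≤ m = 2b + d%2`; the density letters from ★ p865144 per parity at `(n := b)`,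
`hnb := le_rfl`; `exact topCell_identity … hdensH hdensA`.
WHAT IS NOT CLAIMED: the top laws (★ A2-TOP), the density (★ A5-SIZES), the chart (★ A1-top), the `N = 0` corner (‹D0›: (δ)∕(α)∕(γ)∕(2b) road), the inside window (★ A1–A4),
any census identity; ‹CORE›∕‹CORE-ODD› and (β₂) stay HYPOTHESES of their consumers.
HONEST LABEL.  Count-neutral wrapper over ★ pieces; nothing printed is asserted; no census law is stated; `HC_CM` is proved only modulo the 7 printed citations (2 remaining
named inputs: hLiu418 = `stmt-HodgeConjecture-24832`, h413 = `stmt-HodgeConjecture-24833`) until rung 0 closes.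
## References
* [Kottwitz1986BaseChangeUnits] R. E. Kottwitz, *Base change for unit elements of Hecke algebras*, Compositio Math. 60 (1986): §1 pp. 240–241 (signed lattice counts cell by cell).
* [LabesseLanglands1979] J.-P. Labesse, R. P. Langlands, *L-indistinguishability for SL(2)*, Canad. J. Math. 31 (1979): §2 (2.2) p. 9 (κ-signed counts).
* [Rogawski1990] J. D. Rogawski, *Automorphic Representations of Unitary Groups in Three Variables*, Ann. of Math. Stud. 123 (1990): §4.9 Prop. 4.9.1 (b) p. 55.
* [Serre1979] J.-P. Serre, *Local Fields*, GTM 67 (1979): Ch. V §3 Prop. 5, Cor. 2–3 pp. 84–86; Ch. XIV §2–§3 (systems of representatives of ball classes).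
-/

set_option autoImplicit false

noncomputable section

namespace Summit.HodgeConjecture.HodgeConjecture.Cruxes.H413.F0P3cDyRamTopCellIdentityOfRow

open scoped Valued WithZero Matrix MatrixGroups Classical
open WithZero Finset
open Literature.NumberTheory.Automorphic Literature.NumberTheory.Automorphic.HermitianLattice Literature.NumberTheory.Automorphic.UnitaryLatticeTree
open Literature.NumberTheory.Automorphic.UnitaryThreeFourFrame (IsRamifiedQuadraticDatum normSign)
open Literature.NumberTheory.Rogawski1990
open Summit.HodgeConjecture.HodgeConjecture.Cruxes.H413.F0P3cDyRamFourFramePieces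
open Summit.HodgeConjecture.HodgeConjecture.Cruxes.H413.F0P3cDyRamFourFrameCensusDefs (LatticeInLevel LatticeNearTransvShell)
open Summit.HodgeConjecture.HodgeConjecture.Cruxes.H413.F0P3cDyRamStageOneBDefs (mcOfRecord)
open Summit.HodgeConjecture.HodgeConjecture.Cruxes.H413.F0P3cDyRamToricCensusDefs
open Summit.HodgeConjecture.HodgeConjecture.Cruxes.H413.F0P3cDyRamTopCellIdentity (topCell_identity)
open Summit.HodgeConjecture.HodgeConjecture.Cruxes.H413.F0P3cDyRamRowTopChartLetters (exists_rowTopChart_letters)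
open Summit.HodgeConjecture.HodgeConjecture.Cruxes.H413.F0P3cDyRamTopCellDensityOfRow (exists_topCell_density_of_row exists_topCell_density_of_row_odd)
open Summit.HodgeConjecture.HodgeConjecture.Cruxes.H413.F0P3cDyRamDiagonalFixedClassSystems (exists_repr_fixedBall_card)

variable {E M : Type} [Field E] [Valued E ℤᵐ⁰] [Field M] [Valued M ℤᵐ⁰]

/-! ## §1 HEAD — the top cell identity from the row -/

/-- **HEAD — «THE TOP CELL IDENTITY FROM THE ROW» (K6 DESK WORD #29 (2a); the A6 skeleton's `htop`, `W ≥ 1` branch, as ONE `exact`).**  Two-frame letters of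
‹CORE.v1›∕‹CORE-ODD.v1› BY NAME (★ A5 `topCell_identity`'s, with ‹CORE.v1›'s isotropic vector `hhyper` and its anisotropy premise `haniso`), the dyadic letter, the K6 floor at
`N₀`, the row `1 ≤ b`, `2b + d%2 = m` (BOTH parities), the window `1 ≤ N`, `m + 2N = jl` — and NOTHING ELSE: the TOP chart (★ A1-top), the top digit system modulo `|ϖ|^b`
(★ `exists_repr_fixedBall_card`) and the top density letters (★ A5-SIZES, per parity of `d`) are obtained inside.  THEN `X_H(b + 2N) = if N < d then X_A(b + 2N) else 0` in
★ `topCell_identity`'s conclusion bytes (= ★ (P1) `coreWindow_of_insideWindow_and_topCell`'s `htop` at `j := b + 2N`).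
[cite: Kottwitz1986BaseChangeUnits, §1 pp. 240–241] [cite: LabesseLanglands1979, §2 (2.2) p. 9] [cite: Rogawski1990, §4.9 Prop. 4.9.1 (b) p. 55] [cite: Serre1979, Ch. V §3 Cor. 3; Ch. XIV §2–§3] -/
theorem topCell_identity_of_row [CompleteSpace E] [IsDiscreteValuationRing 𝒪[E]] [Finite 𝓀[E]] [CompleteSpace M] [IsDiscreteValuationRing 𝒪[M]] [Finite 𝓀[M]]
    (σ : E →+* E) (ϖ : E) (d tE : ℕ) (hD : IsRamifiedQuadraticDatum σ ϖ d tE)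
    (jE : E →+* M) (ρ Θ : M →+* M) (α lam : M)
    (hρρ : ∀ z, ρ (ρ z) = z) (hvρ : ∀ z, Valued.v (ρ z) = Valued.v z)
    (hjv : ∀ a, Valued.v (jE a) ≤ 1 ↔ Valued.v a ≤ 1) (hjfix : ∀ z : M, ρ z = z ↔ ∃ a, jE a = z) (hΘj : ∀ a, Θ (jE a) = jE (σ a))
    (hΘΘ : ∀ z, Θ (Θ z) = z) (hΘρ : ∀ z, Θ (ρ z) = ρ (Θ z)) (hvΘ : ∀ z, Valued.v (Θ z) = Valued.v z)
    (hα : ρ α ≠ α) (hα1 : Valued.v α ≤ 1) (hint : ∀ z : M, Valued.v z ≤ 1 → Valued.v ((z - ρ z) / (α - ρ α)) ≤ 1)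
    (hΘlam : Θ lam * lam = 1) (hvlam : Valued.v lam = 1) (hU : Valued.v (α - ρ α) = 1) (hτ : Valued.v (α - Θ α) < 1)
    (hσres : ∀ z : M, ρ z = z → Valued.v z ≤ 1 → Valued.v (Θ z - z) < 1)
    (hDM : IsRamifiedQuadraticDatum Θ (jE ϖ) d tE) (hjiso : ∀ a, Valued.v (jE a) = Valued.v a)
    (hq : Nat.card 𝓀[M] = Nat.card 𝓀[E] ^ 2) (hjpow : ∀ (t : E) (n : ℤ), Valued.v (jE t) = Valued.v (jE ϖ) ^ n ↔ Valued.v t = Valued.v ϖ ^ n)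
    (hϖmax : ∀ t : M, ρ t = t → Valued.v t < 1 → Valued.v t ≤ Valued.v (jE ϖ))
    (u : GL (Fin 1) E) (m jl : ℕ) (hm : Valued.v (lam - jE ((u : Matrix (Fin 1) (Fin 1) E) 0 0)) = WithZero.exp (-(m : ℤ)))
    (hjl : Valued.v ((lam - jE ((u : Matrix (Fin 1) (Fin 1) E) 0 0)) - ρ (lam - jE ((u : Matrix (Fin 1) (Fin 1) E) 0 0))) = WithZero.exp (-(jl : ℤ)))
    (hum : Valued.v (((u : Matrix (Fin 1) (Fin 1) E) 0 0) - 1) ≤ Valued.v (ϖ ^ mstarOfRecord d)) (h2 : ¬ IsUnit (2 : 𝒪[E]))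
    -- the HYPERBOLIC frame `(γ₂, φ, h, f)` in the identity frame (‹CORE.v1›'s `_hΓ _hφs … _hf _hfinLS`) with its isotropic vector (‹CORE.v1›'s `_hhyper`)
    (γ₂ : GL (Fin 2) E) (hΓ : endoGL (γ₂, u) ∈ unitaryGroupOfForm σ ((StdForm.antidiagonal 3).over E))
    (φ : (Fin 2 → E) →+ M) (h : M) (hφs : ∀ (c : E) (x : Fin 2 → E), φ (c • x) = jE c * φ x) (hφi : Function.Injective φ) (hφo : Function.Surjective φ)
    (hφγ : ∀ x, φ ((γ₂ : Matrix (Fin 2) (Fin 2) E).mulVec x) = lam * φ x)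
    (hform : ∀ x y, jE (pairing σ ((StdForm.antidiagonal 2).over E) x y) = h * Θ (φ x) * φ y + ρ (h * Θ (φ x) * φ y)) (hΘh : Θ h = h) (hh : h ≠ 0)
    (hhyper : ∃ x : M, x ≠ 0 ∧ h * Θ x * x + ρ (h * Θ x * x) = 0)
    (f : ℕ → ℕ → AddSubgroup M → ℕ) (hfinLS : ∀ j a, (levelSet ρ Θ α (jE ϖ) h j a).Finite)
    (hf : ∀ (b j : ℕ) (Λ : AddSubgroup M) (x₀ : M) (r : E), 1 ≤ b → x₀ ≠ 0 → (∀ x, x ∈ Λ ↔ ∃ z, IsOrd ρ α (jE ϖ ^ j) z ∧ x = x₀ * z) →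
      IsOrd ρ α (jE ϖ ^ j) (dualGen ρ Θ α (jE ϖ ^ j) h x₀) → ¬ IsOrd ρ α (jE ϖ ^ j) (dualGen ρ Θ α (jE ϖ ^ j) h x₀ / jE ϖ) → Valued.v (dualGen ρ Θ α (jE ϖ ^ j) h x₀) = Valued.v (jE ϖ) ^ b →
      (∀ b', (∀ x ∈ Λ, Valued.v (h * Θ x * b' + ρ (h * Θ x * b')) ≤ 1) → (lam - jE ((u : Matrix (Fin 1) (Fin 1) E) 0 0)) * b' ∈ Λ) → IsOrd ρ α (jE ϖ ^ j) lam →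
      jE r = glueUnit ρ Θ α (jE ϖ ^ j) h (jE ϖ) (jE (1 : E)) x₀ b →
      f b j Λ = Nat.card {x : 𝒪[E] ⧸ 𝓂[E] ^ (2 * b) // ∃ u' : 𝒪[E], Ideal.Quotient.mk (𝓂[E] ^ (2 * b)) u' = x ∧ Valued.v ((u' : E) * σ u' - r) ≤ Valued.v (ϖ ^ (2 * b))})
    -- the ANISOTROPIC frame `(P₁, dg, η, γA, φ′, h′, f′)` (‹CORE.v1›'s `P₁ dg η γ₁ _hA _hΓ' _hdg1 _hdgσ _hησ _hη1 _hηN …`; `γA` = its `γ₁`) with its anisotropy (‹CORE.v1›'s premise)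
    (P₁ : GL (Fin 3) E) (dg : Fin 2 → E) (η : E) (γA : GL (Fin 2) E)
    (hA : formCongr σ P₁ ((StdForm.antidiagonal 3).over E) =
      (!![(Matrix.diagonal dg) 0 0, 0, (Matrix.diagonal dg) 0 1; 0, η, 0; (Matrix.diagonal dg) 1 0, 0, (Matrix.diagonal dg) 1 1] : Matrix (Fin 3) (Fin 3) E))
    (hΓ' : P₁ * endoGL (γA, u) * P₁⁻¹ ∈ unitaryGroupOfForm σ ((StdForm.antidiagonal 3).over E))
    (hdg1 : ∀ i, Valued.v (dg i) = 1) (hdgσ : ∀ i, σ (dg i) = dg i) (hησ : σ η = η) (hη1 : Valued.v η = 1) (hηN : ¬ ∃ t : E, t * σ t = η)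
    (φ' : (Fin 2 → E) →+ M) (h' : M) (hφ's : ∀ (c : E) (x : Fin 2 → E), φ' (c • x) = jE c * φ' x) (hφ'i : Function.Injective φ') (hφ'o : Function.Surjective φ')
    (hφ'γ : ∀ x, φ' ((γA : Matrix (Fin 2) (Fin 2) E).mulVec x) = lam * φ' x)
    (hform' : ∀ x y, jE (pairing σ (Matrix.diagonal dg) x y) = h' * Θ (φ' x) * φ' y + ρ (h' * Θ (φ' x) * φ' y)) (hΘh' : Θ h' = h') (hh' : h' ≠ 0)
    (haniso : ¬ ∃ x : M, x ≠ 0 ∧ h' * Θ x * x + ρ (h' * Θ x * x) = 0)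
    (f' : ℕ → ℕ → AddSubgroup M → ℕ) (hfinLS' : ∀ j a, (levelSet ρ Θ α (jE ϖ) h' j a).Finite)
    (hf' : ∀ (b j : ℕ) (Λ : AddSubgroup M) (x₀ : M) (r : E), 1 ≤ b → x₀ ≠ 0 → (∀ x, x ∈ Λ ↔ ∃ z, IsOrd ρ α (jE ϖ ^ j) z ∧ x = x₀ * z) →
      IsOrd ρ α (jE ϖ ^ j) (dualGen ρ Θ α (jE ϖ ^ j) h' x₀) → ¬ IsOrd ρ α (jE ϖ ^ j) (dualGen ρ Θ α (jE ϖ ^ j) h' x₀ / jE ϖ) → Valued.v (dualGen ρ Θ α (jE ϖ ^ j) h' x₀) = Valued.v (jE ϖ) ^ b →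
      (∀ b', (∀ x ∈ Λ, Valued.v (h' * Θ x * b' + ρ (h' * Θ x * b')) ≤ 1) → (lam - jE ((u : Matrix (Fin 1) (Fin 1) E) 0 0)) * b' ∈ Λ) → IsOrd ρ α (jE ϖ ^ j) lam →
      jE r = glueUnit ρ Θ α (jE ϖ ^ j) h' (jE ϖ) (jE η) x₀ b →
      f' b j Λ = Nat.card {x : 𝒪[E] ⧸ 𝓂[E] ^ (2 * b) // ∃ u' : 𝒪[E], Ideal.Quotient.mk (𝓂[E] ^ (2 * b)) u' = x ∧ Valued.v ((u' : E) * σ u' - r) ≤ Valued.v (ϖ ^ (2 * b))})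
    -- the K6 floor (‹CORE.v1›'s `_hNm _hu1N _hlam1` at the assembler's fence value `N₀`, and `4d ≤ N₀`)
    {N₀ : ℕ} (h4d : 4 * d ≤ N₀) (hN₀m : N₀ ≤ m)
    (hu1N : Valued.v (((u : Matrix (Fin 1) (Fin 1) E) 0 0) - 1) ≤ Valued.v (ϖ ^ N₀)) (hlam1 : Valued.v (lam - 1) ≤ Valued.v (jE ϖ ^ N₀))
    -- the live row (both parities) and its window, `N ≥ 1`
    (b : ℕ) (hb1 : 1 ≤ b) (hbm : 2 * b + d % 2 = m) {N : ℕ} (hN1 : 1 ≤ N) (hNjl : m + 2 * N = jl) :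
    (((∑ᶠ Λ ∈ levelSetDep ρ Θ α (jE ϖ) h (b + 2 * N) b (lam - jE ((u : Matrix (Fin 1) (Fin 1) E) 0 0)) ∩
          {Λ | ∃ B : Submodule 𝒪[E] (Fin 2 → E), B.toAddSubgroup.map φ = Λ ∧
            ∃ L₃ : Submodule 𝒪[E] (Fin 3 → E), IsSelfDualLattice σ ϖ (!![((StdForm.antidiagonal 2).over E) 0 0, 0, ((StdForm.antidiagonal 2).over E) 0 1; 0, (1 : E), 0; ((StdForm.antidiagonal 2).over E) 1 0, 0, ((StdForm.antidiagonal 2).over E) 1 1] : Matrix (Fin 3) (Fin 3) E) L₃ ∧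
              L₃ ⊓ LinearMap.ker ((LinearMap.proj (1 : Fin 3) : (Fin 3 → E) →ₗ[E] E).restrictScalars 𝒪[E]) =
                B.map ((Matrix.toLin' (!![1, 0; 0, 0; 0, 1] : Matrix (Fin 3) (Fin 2) E)).restrictScalars 𝒪[E]) ∧
              (∀ c : E, (Pi.single 1 c : Fin 3 → E) ∈ L₃ ↔ Valued.v c ≤ Valued.v ϖ ^ b) ∧
              (LatticeNearTransvShell ϖ (d % 2) (mstarOfRecord d) ((((endoGL (γ₂, u) : GL (Fin 3) E) : Matrix (Fin 3) (Fin 3) E) - 1)) L₃ ∧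
                {z : E | ∃ y ∈ L₃, Valued.v ((ϖ ^ (mstarOfRecord d))⁻¹ * (z - pairing σ (!![((StdForm.antidiagonal 2).over E) 0 0, 0, ((StdForm.antidiagonal 2).over E) 0 1; 0, (1 : E), 0; ((StdForm.antidiagonal 2).over E) 1 0, 0, ((StdForm.antidiagonal 2).over E) 1 1] : Matrix (Fin 3) (Fin 3) E) y (((((endoGL (γ₂, u) : GL (Fin 3) E) : Matrix (Fin 3) (Fin 3) E) - 1)) *ᵥ y))) ≤ 1} =
                  valueSetMod σ ϖ (mstarOfRecord d) (xPlus σ ϖ d))}, f b (b + 2 * N) Λ : ℕ) : ℤ) -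
        ((∑ᶠ Λ ∈ levelSetDep ρ Θ α (jE ϖ) h (b + 2 * N) b (lam - jE ((u : Matrix (Fin 1) (Fin 1) E) 0 0)) ∩
          {Λ | ∃ B : Submodule 𝒪[E] (Fin 2 → E), B.toAddSubgroup.map φ = Λ ∧
            ∃ L₃ : Submodule 𝒪[E] (Fin 3 → E), IsSelfDualLattice σ ϖ (!![((StdForm.antidiagonal 2).over E) 0 0, 0, ((StdForm.antidiagonal 2).over E) 0 1; 0, (1 : E), 0; ((StdForm.antidiagonal 2).over E) 1 0, 0, ((StdForm.antidiagonal 2).over E) 1 1] : Matrix (Fin 3) (Fin 3) E) L₃ ∧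
              L₃ ⊓ LinearMap.ker ((LinearMap.proj (1 : Fin 3) : (Fin 3 → E) →ₗ[E] E).restrictScalars 𝒪[E]) =
                B.map ((Matrix.toLin' (!![1, 0; 0, 0; 0, 1] : Matrix (Fin 3) (Fin 2) E)).restrictScalars 𝒪[E]) ∧
              (∀ c : E, (Pi.single 1 c : Fin 3 → E) ∈ L₃ ↔ Valued.v c ≤ Valued.v ϖ ^ b) ∧
              (LatticeNearTransvShell ϖ (d % 2) (mcOfRecord d) ((((endoGL (γ₂, u) : GL (Fin 3) E) : Matrix (Fin 3) (Fin 3) E) - 1)) L₃ ∧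
                ¬ {z : E | ∃ y ∈ L₃, Valued.v ((ϖ ^ (mstarOfRecord d))⁻¹ * (z - pairing σ (!![((StdForm.antidiagonal 2).over E) 0 0, 0, ((StdForm.antidiagonal 2).over E) 0 1; 0, (1 : E), 0; ((StdForm.antidiagonal 2).over E) 1 0, 0, ((StdForm.antidiagonal 2).over E) 1 1] : Matrix (Fin 3) (Fin 3) E) y (((((endoGL (γ₂, u) : GL (Fin 3) E) : Matrix (Fin 3) (Fin 3) E) - 1)) *ᵥ y))) ≤ 1} =
                  valueSetMod σ ϖ (mstarOfRecord d) (xPlus σ ϖ d))}, f b (b + 2 * N) Λ : ℕ) : ℤ)) =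
      if N < d then
        (((∑ᶠ Λ ∈ levelSetDep ρ Θ α (jE ϖ) h' (b + 2 * N) b (lam - jE ((u : Matrix (Fin 1) (Fin 1) E) 0 0)) ∩
          {Λ | ∃ B : Submodule 𝒪[E] (Fin 2 → E), B.toAddSubgroup.map φ' = Λ ∧
            ∃ L₃ : Submodule 𝒪[E] (Fin 3 → E), IsSelfDualLattice σ ϖ (!![(Matrix.diagonal dg) 0 0, 0, (Matrix.diagonal dg) 0 1; 0, η, 0; (Matrix.diagonal dg) 1 0, 0, (Matrix.diagonal dg) 1 1] : Matrix (Fin 3) (Fin 3) E) L₃ ∧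
              L₃ ⊓ LinearMap.ker ((LinearMap.proj (1 : Fin 3) : (Fin 3 → E) →ₗ[E] E).restrictScalars 𝒪[E]) =
                B.map ((Matrix.toLin' (!![1, 0; 0, 0; 0, 1] : Matrix (Fin 3) (Fin 2) E)).restrictScalars 𝒪[E]) ∧
              (∀ c : E, (Pi.single 1 c : Fin 3 → E) ∈ L₃ ↔ Valued.v c ≤ Valued.v ϖ ^ b) ∧
              (LatticeNearTransvShell ϖ (d % 2) (mstarOfRecord d) ((((endoGL (γA, u) : GL (Fin 3) E) : Matrix (Fin 3) (Fin 3) E) - 1)) L₃ ∧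
                {z : E | ∃ y ∈ L₃, Valued.v ((ϖ ^ (mstarOfRecord d))⁻¹ * (z - pairing σ (!![(Matrix.diagonal dg) 0 0, 0, (Matrix.diagonal dg) 0 1; 0, η, 0; (Matrix.diagonal dg) 1 0, 0, (Matrix.diagonal dg) 1 1] : Matrix (Fin 3) (Fin 3) E) y (((((endoGL (γA, u) : GL (Fin 3) E) : Matrix (Fin 3) (Fin 3) E) - 1)) *ᵥ y))) ≤ 1} =
                  valueSetMod σ ϖ (mstarOfRecord d) (xPlus σ ϖ d))}, f' b (b + 2 * N) Λ : ℕ) : ℤ) -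
        ((∑ᶠ Λ ∈ levelSetDep ρ Θ α (jE ϖ) h' (b + 2 * N) b (lam - jE ((u : Matrix (Fin 1) (Fin 1) E) 0 0)) ∩
          {Λ | ∃ B : Submodule 𝒪[E] (Fin 2 → E), B.toAddSubgroup.map φ' = Λ ∧
            ∃ L₃ : Submodule 𝒪[E] (Fin 3 → E), IsSelfDualLattice σ ϖ (!![(Matrix.diagonal dg) 0 0, 0, (Matrix.diagonal dg) 0 1; 0, η, 0; (Matrix.diagonal dg) 1 0, 0, (Matrix.diagonal dg) 1 1] : Matrix (Fin 3) (Fin 3) E) L₃ ∧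
              L₃ ⊓ LinearMap.ker ((LinearMap.proj (1 : Fin 3) : (Fin 3 → E) →ₗ[E] E).restrictScalars 𝒪[E]) =
                B.map ((Matrix.toLin' (!![1, 0; 0, 0; 0, 1] : Matrix (Fin 3) (Fin 2) E)).restrictScalars 𝒪[E]) ∧
              (∀ c : E, (Pi.single 1 c : Fin 3 → E) ∈ L₃ ↔ Valued.v c ≤ Valued.v ϖ ^ b) ∧
              (LatticeNearTransvShell ϖ (d % 2) (mcOfRecord d) ((((endoGL (γA, u) : GL (Fin 3) E) : Matrix (Fin 3) (Fin 3) E) - 1)) L₃ ∧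
                ¬ {z : E | ∃ y ∈ L₃, Valued.v ((ϖ ^ (mstarOfRecord d))⁻¹ * (z - pairing σ (!![(Matrix.diagonal dg) 0 0, 0, (Matrix.diagonal dg) 0 1; 0, η, 0; (Matrix.diagonal dg) 1 0, 0, (Matrix.diagonal dg) 1 1] : Matrix (Fin 3) (Fin 3) E) y (((((endoGL (γA, u) : GL (Fin 3) E) : Matrix (Fin 3) (Fin 3) E) - 1)) *ᵥ y))) ≤ 1} =
                  valueSetMod σ ϖ (mstarOfRecord d) (xPlus σ ϖ d))}, f' b (b + 2 * N) Λ : ℕ) : ℤ))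
      else 0 := by
  obtain ⟨hσσ, hvσ, hϖ, hfix, hdiff, -, -⟩ := id hD
  -- the row's TOP chart («A1-top» v2, ★ p865011): the reference pair `(κ₀, ξ₀)` of size `exp 2N`, the coordinates of `μ`, the unit letters and the on-shell dictionary
  obtain ⟨κ₀, ξ₀, μa, μb, R₀, γ₀, α₁, γ₁, hκ₀, hΘκ₀, -, hκ₀v, hξ, hΘξ, -, hξN, hξv, hμab, hR₀, hγ₀, -, -, hα₁σ, hα₁1, hγ₁σ, hγ₁v, -, hαγ, hγα,
    haff⟩ := exists_rowTopChart_letters hD jE hjiso hjfix hΘj hρρ hvρ hΘρ hα hα1 hint hU hDM hq hσres hτ lam ((u : Matrix (Fin 1) (Fin 1) E) 0 0) hm hjl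
      hbm hN1 hNjl
  -- the top digit system `Rt`: a complete irredundant system of `σ`-fixed integral digits modulo `|ϖ|^b` (★ `exists_repr_fixedBall_card` at level `t := 0`)
  obtain ⟨Rt, hRt1, hRt2, hRt3, -⟩ := exists_repr_fixedBall_card hσσ hvσ hfix hϖ hdiff b 0
  simp only [Nat.mul_zero, pow_zero, Nat.add_zero] at hRt1 hRt2 hRt3
  -- the conductor fits under the modulus: `2d − 1 ≤ b` from the floor `4d ≤ N₀ ≤ m = 2b + d%2`
  have hdb : 2 * d - 1 ≤ b := by omega
  -- the top DENSITY letters (★ A5-SIZES p865144), per parity of `d` (the row is `2b = m` for even `d`, `2b + 1 = m` for odd `d`)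
  rcases Nat.mod_two_eq_zero_or_one d with hd0 | hd1
  · obtain ⟨φd, hdensH, hdensA⟩ := exists_topCell_density_of_row σ ϖ d tE hD hσσ h2 jE ρ Θ α lam hρρ hvρ hjv hjfix hΘj hΘΘ hΘρ hvΘ hα hα1 hint hvlam hU hτ
      hσres hDM hjiso hq hjpow hϖmax u m jl hm hjl γ₂ φ h hφs hφi hφo hφγ hform hΘh hh hhyper f hfinLS hf P₁ dg η γA hA hdgσ hησ hη1 hηN φ' h' hφ's hφ'i hφ'o
      hφ'γ hform' hΘh' hh' haniso f' hfinLS' hf' b hb1 (by omega) hNjl hκ₀ hΘκ₀ hκ₀v hξ hΘξ hξN Rt hdb le_rfl hRt1 hRt2 hRt3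
    exact topCell_identity σ ϖ d tE hD jE ρ Θ α lam hρρ hvρ hjv hjfix hΘj hΘΘ hΘρ hvΘ hα hα1 hint hΘlam hvlam hU hτ hσres hDM hjiso hq hjpow hϖmax u m jl hm hjl
      hum h2 γ₂ hΓ φ h hφs hφi hφo hφγ hform hΘh hh f hfinLS hf P₁ dg η γA hA hΓ' hdg1 hdgσ hησ hη1 hηN φ' h' hφ's hφ'i hφ'o hφ'γ hform' hΘh' hh' f' hfinLS' hf'
      h4d hN₀m hu1N hlam1 b hbm hN1 hNjl hκ₀ hΘκ₀ hκ₀v hξ hΘξ hξN hξv hμab hR₀ hγ₀ hα₁σ hα₁1 hγ₁σ hγ₁v hαγ hγα haff Rt hdb le_rfl hRt1 hRt2 hRt3 hdensH hdensA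
  · obtain ⟨φd, hdensH, hdensA⟩ := exists_topCell_density_of_row_odd σ ϖ d tE hD hσσ h2 jE ρ Θ α lam hρρ hvρ hjv hjfix hΘj hΘΘ hΘρ hvΘ hα hα1 hint hvlam hU hτ
      hσres hDM hjiso hq hjpow hϖmax u m jl hm hjl γ₂ φ h hφs hφi hφo hφγ hform hΘh hh hhyper f hfinLS hf P₁ dg η γA hA hdgσ hησ hη1 hηN φ' h' hφ's hφ'i hφ'o
      hφ'γ hform' hΘh' hh' haniso f' hfinLS' hf' b hb1 (by omega) hNjl hκ₀ hΘκ₀ hκ₀v hξ hΘξ hξN Rt hdb le_rfl hRt1 hRt2 hRt3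
    exact topCell_identity σ ϖ d tE hD jE ρ Θ α lam hρρ hvρ hjv hjfix hΘj hΘΘ hΘρ hvΘ hα hα1 hint hΘlam hvlam hU hτ hσres hDM hjiso hq hjpow hϖmax u m jl hm hjl
      hum h2 γ₂ hΓ φ h hφs hφi hφo hφγ hform hΘh hh f hfinLS hf P₁ dg η γA hA hΓ' hdg1 hdgσ hησ hη1 hηN φ' h' hφ's hφ'i hφ'o hφ'γ hform' hΘh' hh' f' hfinLS' hf'
      h4d hN₀m hu1N hlam1 b hbm hN1 hNjl hκ₀ hΘκ₀ hκ₀v hξ hΘξ hξN hξv hμab hR₀ hγ₀ hα₁σ hα₁1 hγ₁σ hγ₁v hαγ hγα haff Rt hdb le_rfl hRt1 hRt2 hRt3 hdensH hdensA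

end Summit.HodgeConjecture.HodgeConjecture.Cruxes.H413.F0P3cDyRamTopCellIdentityOfRow

end
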